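import Literature.Algebra.Homology.DiscreteRepStandardResolution
import Literature.Algebra.Homology.DiscreteRepRestrictionExact
import Literature.Algebra.Homology.ExtOfResolutionComparisonMap
import Mathlib.RepresentationTheory.Homological.ContCohomology.Functoriality
import HarnessLib

/-!
# The comparison `Extⁿ_{C_Γ}(k, X) ≅ Hⁿ_cont(Γ, X)` commutes with PULLBACK along any continuous
# homomorphism `φ : H → Γ` (and a coefficient map `f : φ^*X → Y`)

Topic `Algebra/Homology`; namespace `Literature.Algebra.Homology.DiscreteRep`.  Sequel of
`DiscreteRepStandardResolution` (the comparison `Φ_X = extTrivAddEquivContinuousCohomology`),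
`DiscreteRepRestrictionExact` (the exact pullback functor `resDHom k φ hφ : C_Γ ⥤ C_H`) and
`ExtOfResolutionComparisonMap` (the comparison map `θ` of an arbitrary exact augmented complex and its
naturality); no named fact, no `sorry`.

Let `Γ`, `H` be COMPACT topological groups, `φ : H →ₜ* Γ` a continuous homomorphism — NOT assumed
injective (e.g. a decomposition map `Γ_{K_v} → Γ_K ↠ G_S`) —, `X` (resp. `Y`) a topologically discrete
`k`-linear representation of `Γ` (resp. `H`) with open stabilisers, and `f : φ^*X ⟶ Y` a morphism of
topological `H`-representations (Mathlib's `TopRep.res`).  **Theorem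
(`extTrivAddEquivContinuousCohomology_resDHom`).**  For `x ∈ Extⁿ_{C_Γ}(k, X)`,

  `Hⁿ(φ, f) (Φ_X x) = Φ_Y (f_* (φ^* x))`,

where `Hⁿ(φ, f) : Hⁿ_cont(Γ, X) → Hⁿ_cont(H, Y)` is Mathlib's `ContinuousCohomology.map φ f n`,
`φ^* x = Ext.mapExactFunctor (resDHom k φ _) x` and `f_*` is composition with `f` read in `C_H`
(`pullbackHomD`).  Special cases: `f = 𝟙` is the compatibility with pullback / inflation-restriction
along `φ` (Harari §1.5, Definition 1.33 and §4.3 (2): `f^* : Hⁿ(G, A) → Hⁿ(G', f^*A)` for any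
morphism of profinite groups), and `φ = id` the naturality in the module
(`DiscreteRepStandardResolutionNaturality`); the open-subgroup case is
`DiscreteRepStandardResolutionRestriction`.

Proof.  `φ^*` of Mathlib's standard complex of `X` is an exact augmented complex of `φ^*X` in `C_H`
(`φ^*` is exact) mapping to the standard complex of `Y` by Mathlib's `resolutionMap φ f`
(`stdComplexPullbackMap`), but for non-injective `φ` it is NOT `Ext_{C_H}(k, –)`-acyclic, so the
engine's `extAddEquivHomologySucc_map/_naturality` do not apply; instead the inverse comparison `θ`
of `ExtOfResolutionComparisonMap` — defined for every exact augmented complex and natural under exact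
functors (`homologyToExt_map`) and cochain maps (`homologyToExt_naturality`) with no acyclicity — is
chased through `Ext(k, std_Γ X) → Ext(k, φ^* std_Γ X) → Ext(k, std_H Y)`, and identified with
`Φ⁻¹` at the two acyclic ends.  The cochain side is Mathlib's `cochainsMap φ f`
(`extComplexIso_pullback`).

## References
* D. Harari, *Galois Cohomology and Class Field Theory*, Springer (2020), §1.5 Definition 1.33
  (compatible pairs, `f^*`), §4.3 (2) and Remark 4.24. [Harari2020]
* J.-P. Serre, *Galois Cohomology*, Springer (1997), I §2.2, §2.5. [SerreGaloisCohomology1997]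
* C. A. Weibel, *An introduction to homological algebra* (1994), §2.4, Thm. 2.7.6. [Weibel1994]
-/

noncomputable section

universe u

namespace Literature.Algebra.Homology

namespace DiscreteRep

open CategoryTheory CategoryTheory.Limits CategoryTheory.Abelian TopRep ContRepresentation
  ContinuousCohomology

variable {k Γ H : Type u} [CommRing k] [TopologicalSpace k] [Group Γ] [TopologicalSpace Γ]
  [IsTopologicalGroup Γ] [CompactSpace Γ] [Group H] [TopologicalSpace H] [IsTopologicalGroup H]
  [CompactSpace H] (φ : H →ₜ* Γ)
  {X : TopRep.{u} k Γ} [DiscreteTopology X.V] (hX : IsDiscrete ((forgetTop k Γ).obj X))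
  {Y : TopRep.{u} k H} [DiscreteTopology Y.V] (hY : IsDiscrete ((forgetTop k H).obj Y))
  (f : TopRep.res (φ : H →* Γ) X ⟶ Y)

/-! ## §1 Pullback of the standard complex along `φ` -/

omit [IsTopologicalGroup Γ] [CompactSpace Γ] [IsTopologicalGroup H] [CompactSpace H] in
/-- Continuity of `φ` read on the underlying monoid homomorphism `(φ : H →* Γ)` (the coercion used by
Mathlib's `TopRep.res`); stated separately so that the proof has this exact type. [cite: Harari2020, §4.2] -/
theorem continuous_coe_monoidHom : Continuous ⇑(φ : H →* Γ) := map_continuous φ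

variable (k) in
/-- **The exact pullback functor `φ^* : C_Γ ⥤ C_H`** along the continuous homomorphism `φ`
(`DiscreteRepRestrictionExact.resDHom`). [cite: Harari2020, §4.2 and §1.5] -/
abbrev pullD : DiscreteRepCat k Γ ⥤ DiscreteRepCat k H :=
  resDHom k (φ : H →* Γ) (continuous_coe_monoidHom φ)

/-- `φ^* X` (Mathlib's `TopRep.res`) is still topologically discrete. [cite: Harari2020, §4.2] -/
instance discreteTopology_resHom : DiscreteTopology (TopRep.res (φ : H →* Γ) X).V :=
  inferInstanceAs (DiscreteTopology X.V)

include hX in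
omit [IsTopologicalGroup Γ] [CompactSpace Γ] [IsTopologicalGroup H] [CompactSpace H]
  [DiscreteTopology X.V] in
/-- `φ^* X` still has open stabilisers. [cite: Harari2020, §4.2] -/
theorem isDiscrete_resHomTop : IsDiscrete ((forgetTop k H).obj (TopRep.res (φ : H →* Γ) X)) :=
  isDiscrete_resHom (φ : H →* Γ) (continuous_coe_monoidHom φ) (mk ((forgetTop k Γ).obj X) hX)

/-- `φ^* (stdBase X) = stdBase (φ^* X)` in `C_H`, definitionally. [cite: Harari2020, §4.3] -/
theorem pullD_stdBase :
    (pullD k φ).obj (stdBase X hX) = stdBase (TopRep.res (φ : H →* Γ) X) (isDiscrete_resHomTop φ hX) :=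
  rfl

/-- The coefficient map `f : φ^*X ⟶ Y` read in `C_H`: `φ^*(stdBase X) ⟶ stdBase Y`.
[cite: Harari2020, §1.5 Definition 1.33] -/
def pullbackHomD : (pullD k φ).obj (stdBase X hX) ⟶ stdBase Y hY :=
  ObjectProperty.homMk (X := (pullD k φ).obj (stdObj X hX 0)) (Y := stdObj Y hY 0) ((forgetTop k H).map f)

/-- Formula: `pullbackHomD` is `f` on underlying vectors. [cite: Harari2020, §1.5 Definition 1.33] -/
@[simp]
theorem pullbackHomD_hom_apply (v : X.V) : (pullbackHomD φ hX hY f).hom.hom v = f.hom v := rfl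

/-- **The morphism `φ^*(std_Γ X) ⟶ std_H Y` of complexes in `C_H`** (Mathlib's `resolutionMap φ f`:
`F ↦ f ∘ F ∘ φ`, iteratively). [cite: Harari2020, §4.3 and §1.5 Definition 1.33] -/
def stdComplexPullbackMap :
    AcyclicResolution.mapComplex (pullD k φ) (stdComplex X hX) ⟶ stdComplex Y hY where
  f n := ObjectProperty.homMk (X := (pullD k φ).obj (stdObj X hX (n + 1))) (Y := stdObj Y hY (n + 1))
    ((forgetTop k H).map (resolutionMap φ f (n + 1)))
  comm' i j hij := by
    obtain rfl : i + 1 = j := hij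
    rw [stdComplex_d]
    change _ = (pullD k φ).map ((stdComplex X hX).d i (i + 1)) ≫ _
    rw [stdComplex_d]
    refine ObjectProperty.hom_ext _ (Rep.hom_ext (DFunLike.ext _ _ fun v => ?_))
    change (TopRep.d Y (i + 1)).hom ((resolutionMap φ f (i + 1)).hom v) =
      (resolutionMap φ f (i + 1 + 1)).hom ((TopRep.d X (i + 1)).hom v)
    exact congrArg (fun T => TopRep.Hom.hom T v) (resolutionMap_comp_d φ f (i + 1))

/-- Components of `stdComplexPullbackMap`, elementwise. [cite: Harari2020, §4.3] -/
@[simp]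
theorem stdComplexPullbackMap_f_apply (n : ℕ) (v : (resolutionX X (n + 1)).V) :
    ((stdComplexPullbackMap φ hX hY f).f n).hom.hom v = (resolutionMap φ f (n + 1)).hom v := rfl

/-- The augmentations commute: `φ^* η_X ≫ (pullback map)⁰ = f ≫ η_Y`. [cite: Harari2020, §4.3] -/
theorem stdη_pullback :
    (pullD k φ).map (stdη X hX) ≫ (stdComplexPullbackMap φ hX hY f).f 0 =
      pullbackHomD φ hX hY f ≫ stdη Y hY := by
  refine ObjectProperty.hom_ext _ (Rep.hom_ext (DFunLike.ext _ _ fun v => ?_))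
  change (resolutionMap φ f (0 + 1)).hom ((TopRep.d X 0).hom v) = (TopRep.d Y 0).hom (f.hom v)
  have h := DFunLike.congr_fun (congrArg TopRep.Hom.hom (resolutionMap_comp_d φ f 0)) v
  exact h.symm

/-! ## §2 Compatibility with Mathlib's `cochainsMap φ f` -/

/-- Mathlib's cochain map `cochainsMap φ f` on homogeneous cochains, pushed to `Ab`.
[cite: Harari2020, §4.3] -/
abbrev cochainsAbPullbackMap : cochainsAb X ⟶ cochainsAb Y :=
  ((forgetAb k).mapHomologicalComplex (ComplexShape.up ℕ)).map (cochainsMap φ f)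

/-- The composite cochain map `Ext⁰_{C_Γ}(k, std_Γ X) → Ext⁰_{C_H}(k, φ^* std_Γ X) → Ext⁰_{C_H}(k, std_H Y)`.
[cite: Harari2020, §4.3, Remark 4.24] -/
def extComplexPullbackMap :
    AcyclicResolution.extComplex (triv (Γ := Γ) k) (stdComplex X hX) ⟶
      AcyclicResolution.extComplex (triv (Γ := H) k) (stdComplex Y hY) :=
  AcyclicResolution.extComplexMapF (pullD k φ) (triv (Γ := Γ) k) (stdComplex X hX) ≫
    AcyclicResolution.extComplexMap (triv (Γ := H) k) (stdComplexPullbackMap φ hX hY f)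

/-- **`extComplexIso` intertwines `extComplexPullbackMap` with Mathlib's `cochainsMap φ f`.**
[cite: Harari2020, §4.3, Remark 4.24] -/
theorem extComplexIso_pullback :
    extComplexPullbackMap φ hX hY f ≫ (extComplexIso Y hY).hom =
      (extComplexIso X hX).hom ≫ cochainsAbPullbackMap φ f := by
  refine HomologicalComplex.hom_ext _ _ fun n => ?_
  unfold extComplexPullbackMap
  rw [HomologicalComplex.comp_f, HomologicalComplex.comp_f, HomologicalComplex.comp_f]
  ext x
  apply Subtype.ext
  have hx : Ext.addEquiv₀ (x.mapExactFunctor (pullD k φ)) = (pullD k φ).map (Ext.addEquiv₀ x) := by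
    conv_lhs => rw [← Ext.mk₀_addEquiv₀_apply x]
    rw [Ext.mapExactFunctor_mk₀, ← Ext.addEquiv₀_symm_apply, AddEquiv.apply_symm_apply]
  change (Ext.addEquiv₀ (((x.mapExactFunctor (pullD k φ))).comp
      (Ext.mk₀ ((stdComplexPullbackMap φ hX hY f).f n)) (add_zero 0))).hom.hom (1 : k) =
    (resolutionMap φ f (n + 1)).hom ((Ext.addEquiv₀ x).hom.hom (1 : k))
  rw [addEquiv₀_comp_mk₀, hx]
  rfl

/-- **On homology: `Hⁿ(extComplexPullbackMap)` corresponds to Mathlib's `ContinuousCohomology.map φ f n`.**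
[cite: Harari2020, §4.3, Remark 4.24] -/
theorem extComplexHomologyIso_pullback (n : ℕ) :
    HomologicalComplex.homologyMap (extComplexPullbackMap φ hX hY f) n ≫
        (extComplexHomologyIso Y hY n).hom =
      (extComplexHomologyIso X hX n).hom ≫ (forgetAb k).map (ContinuousCohomology.map φ f n) := by
  have h1 : HomologicalComplex.homologyMap (extComplexPullbackMap φ hX hY f) n ≫
      ((HomologicalComplex.homologyFunctor _ _ n).mapIso (extComplexIso Y hY)).hom =
      ((HomologicalComplex.homologyFunctor _ _ n).mapIso (extComplexIso X hX)).hom ≫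
        HomologicalComplex.homologyMap (cochainsAbPullbackMap φ f (X := X) (Y := Y)) n := by
    change HomologicalComplex.homologyMap _ n ≫ HomologicalComplex.homologyMap _ n =
      HomologicalComplex.homologyMap _ n ≫ HomologicalComplex.homologyMap _ n
    rw [← HomologicalComplex.homologyMap_comp, ← HomologicalComplex.homologyMap_comp,
      extComplexIso_pullback]
  have h2 : HomologicalComplex.homologyMap (cochainsAbPullbackMap φ f (X := X) (Y := Y)) n ≫
      (((homogeneousCochains Y).sc n).mapHomologyIso (forgetAb k)).hom =
      (((homogeneousCochains X).sc n).mapHomologyIso (forgetAb k)).hom ≫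
        (forgetAb k).map (ContinuousCohomology.map φ f n) :=
    ShortComplex.mapHomologyIso_hom_naturality
      ((HomologicalComplex.shortComplexFunctor _ _ n).map (cochainsMap φ f)) (forgetAb k)
  change _ ≫ (_ ≫ _) = (_ ≫ _) ≫ _
  exact ((Category.assoc _ _ _).symm.trans (eq_whisker h1 _)).trans
    ((Category.assoc _ _ _).trans ((whisker_eq _ h2).trans (Category.assoc _ _ _).symm))

/-! ## §3 The comparison commutes with pullback -/

/-- The abstract identifications `Extⁿ(k, ·) ≃+ Hⁿ(Ext⁰(k, std))` over `Γ` and over `H` are intertwined by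
`x ↦ f_* (φ^* x)` and `Hⁿ(extComplexPullbackMap)` — via the comparison map `θ` of
`ExtOfResolutionComparisonMap` (the middle complex `φ^* std_Γ X` is exact but not acyclic).
[cite: Harari2020, §4.3, Remark 4.24][cite: Weibel1994, §2.4 Thm. 2.7.6] -/
theorem extTrivAddEquivExtComplexHomology_resDHom (n : ℕ) (x : Ext (triv (Γ := Γ) k) (stdBase X hX) n) :
    (HomologicalComplex.homologyMap (extComplexPullbackMap φ hX hY f) n).hom
        (extTrivAddEquivExtComplexHomology X hX n x) =
      extTrivAddEquivExtComplexHomology Y hY n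
        ((x.mapExactFunctor (pullD k φ)).comp (Ext.mk₀ (pullbackHomD φ hX hY f)) (add_zero n)) := by
  -- `φ^* η_X`, read as the augmentation `φ^* X ⟶ (φ^* std_Γ X)⁰`, is a monomorphism (the engine's repackaging)
  haveI := AcyclicResolution.mono_map_augmentation (pullD k φ) (stdComplex X hX) (stdη X hX)
  unfold extComplexPullbackMap
  rw [HomologicalComplex.homologyMap_comp]
  change (HomologicalComplex.homologyMap
      (AcyclicResolution.extComplexMap (triv (Γ := H) k) (stdComplexPullbackMap φ hX hY f)) n).hom
      ((HomologicalComplex.homologyMap (AcyclicResolution.extComplexMapF (pullD k φ) (triv (Γ := Γ) k)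
        (stdComplex X hX)) n).hom (extTrivAddEquivExtComplexHomology X hX n x)) = _
  cases n with
  | zero =>
    have hA := AcyclicResolution.extAddEquivHomologyZero_map (pullD k φ) (triv (Γ := Γ) k)
      (stdComplex X hX) (stdη X hX) (stdη_d X hX) (exact_stdη X hX) x
    have hB := AcyclicResolution.extAddEquivHomologyZero_naturality (triv (Γ := H) k)
      (stdComplexPullbackMap φ hX hY f) ((pullD k φ).map (stdη X hX))
      (AcyclicResolution.map_hη (pullD k φ) (stdComplex X hX) (stdη X hX) (stdη_d X hX))
      (AcyclicResolution.map_exact_augmentation (pullD k φ) (stdComplex X hX) (stdη X hX) (stdη_d X hX)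
        (exact_stdη X hX))
      (stdη Y hY) (stdη_d Y hY) (exact_stdη Y hY) (pullbackHomD φ hX hY f) (stdη_pullback φ hX hY f)
      (x.mapExactFunctor (pullD k φ))
    exact (congrArg _ hA).trans hB
  | succ n =>
    -- notation: `c = E_X x`, `c₁ = Hⁿ⁺¹(φ^*_*) c`; the three `θ`'s
    have h1 : AcyclicResolution.homologyToExt (triv (Γ := Γ) k) (stdComplex X hX)
        (stdComplex_exactAt_succ X hX) (stdη X hX) (stdη_d X hX) (exact_stdη X hX) n
        (extTrivAddEquivExtComplexHomology X hX (n + 1) x) = x :=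
      AcyclicResolution.homologyToExt_extAddEquivHomologySucc (triv (Γ := Γ) k) (stdComplex X hX)
        (stdComplex_exactAt_succ X hX) (stdη X hX) (stdη_d X hX) (exact_stdη X hX)
        (ext_triv_stdComplex_X_eq_zero X hX) n x
    have h2 : AcyclicResolution.homologyToExt (triv (Γ := H) k)
        (AcyclicResolution.mapComplex (pullD k φ) (stdComplex X hX))
        (AcyclicResolution.map_exactAt (pullD k φ) (stdComplex X hX) (stdComplex_exactAt_succ X hX))
        ((pullD k φ).map (stdη X hX))
        (AcyclicResolution.map_hη (pullD k φ) (stdComplex X hX) (stdη X hX) (stdη_d X hX))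
        (AcyclicResolution.map_exact_augmentation (pullD k φ) (stdComplex X hX) (stdη X hX) (stdη_d X hX)
          (exact_stdη X hX)) n
        ((HomologicalComplex.homologyMap (AcyclicResolution.extComplexMapF (pullD k φ) (triv (Γ := Γ) k)
          (stdComplex X hX)) (n + 1)).hom (extTrivAddEquivExtComplexHomology X hX (n + 1) x)) =
        x.mapExactFunctor (pullD k φ) := by
      have h := AcyclicResolution.homologyToExt_map (pullD k φ) (triv (Γ := Γ) k) (stdComplex X hX)
        (stdComplex_exactAt_succ X hX) (stdη X hX) (stdη_d X hX) (exact_stdη X hX) n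
        (extTrivAddEquivExtComplexHomology X hX (n + 1) x)
      rw [h1] at h
      exact h
    have h3 := AcyclicResolution.homologyToExt_naturality (triv (Γ := H) k)
      (stdComplexPullbackMap φ hX hY f)
      (AcyclicResolution.map_exactAt (pullD k φ) (stdComplex X hX) (stdComplex_exactAt_succ X hX))
      (stdComplex_exactAt_succ Y hY) ((pullD k φ).map (stdη X hX))
      (AcyclicResolution.map_hη (pullD k φ) (stdComplex X hX) (stdη X hX) (stdη_d X hX))
      (AcyclicResolution.map_exact_augmentation (pullD k φ) (stdComplex X hX) (stdη X hX) (stdη_d X hX)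
        (exact_stdη X hX))
      (stdη Y hY) (stdη_d Y hY) (exact_stdη Y hY) (pullbackHomD φ hX hY f) (stdη_pullback φ hX hY f) n
      ((HomologicalComplex.homologyMap (AcyclicResolution.extComplexMapF (pullD k φ) (triv (Γ := Γ) k)
        (stdComplex X hX)) (n + 1)).hom (extTrivAddEquivExtComplexHomology X hX (n + 1) x))
    rw [h2] at h3
    -- `LHS = E_Y (θ_Y LHS) = E_Y (φ^* x ∘ f)` (the goal is type-correct only up to `φ^*(triv k) = triv k`,
    -- which holds by `rfl` but not reducibly, so we conclude by `Eq.trans` rather than `rw`)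
    exact ((AcyclicResolution.extAddEquivHomologySucc_homologyToExt (triv (Γ := H) k) (stdComplex Y hY)
      (stdComplex_exactAt_succ Y hY) (stdη Y hY) (stdη_d Y hY) (exact_stdη Y hY)
      (ext_triv_stdComplex_X_eq_zero Y hY) n _).symm.trans
      (congrArg (extTrivAddEquivExtComplexHomology Y hY (n + 1)) h3))

/-- **THE COMPARISON COMMUTES WITH PULLBACK ALONG ANY CONTINUOUS HOMOMORPHISM.**  For `Γ`, `H`
compact, `φ : H →ₜ* Γ` continuous (not necessarily injective), `f : φ^*X ⟶ Y` and
`x ∈ Extⁿ_{C_Γ}(k, X)`: `Hⁿ(φ, f) (Φ_X x) = Φ_Y (φ^* x ∘ f)`, with `Hⁿ(φ, f)` Mathlib's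
`ContinuousCohomology.map φ f n : Hⁿ_cont(Γ, X) → Hⁿ_cont(H, Y)` and `φ^* x` the image under the
exact functor `resDHom k φ _ : C_Γ ⥤ C_H` (`Ext.mapExactFunctor`).
[cite: Harari2020, §1.5 Definition 1.33, §4.3 (2) and Remark 4.24] -/
theorem extTrivAddEquivContinuousCohomology_resDHom (n : ℕ) (x : Ext (triv (Γ := Γ) k) (stdBase X hX) n) :
    (ContinuousCohomology.map φ f n).hom (extTrivAddEquivContinuousCohomology X hX n x) =
      extTrivAddEquivContinuousCohomology Y hY n
        ((x.mapExactFunctor (pullD k φ)).comp (Ext.mk₀ (pullbackHomD φ hX hY f)) (add_zero n)) := by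
  change ((extComplexHomologyIso X hX n).hom ≫ (forgetAb k).map (ContinuousCohomology.map φ f n)).hom
      (extTrivAddEquivExtComplexHomology X hX n x) =
    (extComplexHomologyIso Y hY n).hom.hom
      (extTrivAddEquivExtComplexHomology Y hY n
        ((x.mapExactFunctor (pullD k φ)).comp (Ext.mk₀ (pullbackHomD φ hX hY f)) (add_zero n)))
  rw [← extComplexHomologyIso_pullback φ hX hY f, ← extTrivAddEquivExtComplexHomology_resDHom φ hX hY f]
  rfl

/-- The case `f = 𝟙`: **`Hⁿ(φ) (Φ_X x) = Φ_{φ^*X} (φ^* x)`** for Mathlib's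
`ContinuousCohomology.map φ (𝟙 (φ^*X))`. [cite: Harari2020, §4.3 (2) and Remark 4.24] -/
theorem extTrivAddEquivContinuousCohomology_resDHom_id (n : ℕ) (x : Ext (triv (Γ := Γ) k) (stdBase X hX) n) :
    (ContinuousCohomology.map φ (𝟙 (TopRep.res (φ : H →* Γ) X)) n).hom
        (extTrivAddEquivContinuousCohomology X hX n x) =
      extTrivAddEquivContinuousCohomology (TopRep.res (φ : H →* Γ) X) (isDiscrete_resHomTop φ hX) n
        (x.mapExactFunctor (pullD k φ)) := by
  rw [extTrivAddEquivContinuousCohomology_resDHom φ hX (isDiscrete_resHomTop φ hX) (𝟙 _) n x]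
  congr 1
  exact Ext.comp_mk₀_id _

end DiscreteRep

end Literature.Algebra.Homology
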